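import Mathlib
import HarnessLib
import Literature.MathematicalPhysics.QuantumLattice.GaugeGroups
import Literature.MathematicalPhysics.QuantumFieldTheory.ConstructiveQFTWave0
import Literature.MathematicalPhysics.QuantumFieldTheory.UnitaryCayleyChart
import Summits.Ventures.LatticeQCDFlow.Scaling.ExactTransportSteps
import Summits.Ventures.LatticeQCDFlow.Scaling.ExactTransportOneSided
import Summits.Ventures.LatticeQCDFlow.Scaling.ExactTransportOneSidedInstances
import Summits.Ventures.LatticeQCDFlow.Scaling.ExactTransportDepth

/-!
# LatticeQCDFlow / Scaling — the expansion law BETWEEN COUPLINGS (file 1 of 2): the items and the volume-uniform inequalities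

HONEST FRAMING: exact (Metropolis-corrected) sampling algorithms for lattice gauge theory; figures of merit are
autocorrelation/cost numbers at stated couplings and volumes; no continuum-physics claim.

Venture `LatticeQCDFlow` (cell pub-lqcd), topic `Scaling`, FANOUT row 29 (theory-2) — OUR WORK (THEORY-2.md §3.3
v2.7, "(C2a-E′) between couplings").  The tree's expansion law `ExactTransportExpansion` /
`exactTransportExpansion_of_ballVolumes` (`Scaling/ExactTransportSteps.lean`, `Scaling/ExactTransportOneSided.lean`)
bounds the Lipschitz constant of an exact transport of the PRODUCT HAAR prior onto the Wilson law `μ_{Λ,β}`: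
`Lip(T) ≥ e^{cβ}`.  The flows actually trained in the lattice literature are increasingly flows BETWEEN COUPLINGS
(a thermalised ensemble at `β₀` is transported to `β > β₀`), and the natural question is whether starting at
`β₀ > 0` evades the law.  It does not: the obstruction is in the coupling WINDOW `β - β₀`.  This file types the
items and proves the volume-uniform inequalities; `Scaling/ExactTransportBetween.lean` (file 2) assembles the law
and discharges every hypothesis for `U(1)`, `U(N)`, `SU(N)`.

* `ExactTransportExpansionBetween d N G ρ` (item, (C2a-E′)): there are `c > 0`, `C` such that for every `L ≥ 2`,
  every `0 ≤ β₀ ≤ β` and every exact LIPSCHITZ transport `T_* μ_{Λ,β₀} = μ_{Λ,β}` (sup metric on `G^E`),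
  `Lip(T) ≥ e^{c(β-β₀) - C}` — uniformly in the volume.
* `LayerExpansionDepthBetween d N G ρ` (item): a stack of `n` layers, each `Λ`-Lipschitz, realising
  `μ_{β₀} → μ_β` exactly has `n·log Λ ≥ c(β-β₀) - C`.
* STEP 1′ (`log_partitionFunction_add_le_between`): comparing `μ_{β₀}(B̄(x,r))` with
  `μ_β(B̄(Tx,Kr)) ⊇ T(B̄(x,r))` as `r → 0` gives, at EVERY `x` and for two-sided ball volumes
  `a·r^κ ≤ Haar(B̄(g,r)) ≤ A·r^κ`,  `log Z_β - log Z_{β₀} + β·S(Tx) - β₀·S(x) ≤ #E·(log(A/a) + κ·log K)`.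
* SUBLEVEL MONOTONICITY (`pi_sublevel_mul_partitionFunction_le`, Chebyshev's order inequality for the comonotone
  pair `1_{S ≤ s}`, `e^{-β₀S}`, proved by splitting `Z_{β₀}` at the level `s`): `π{S ≤ s}·Z_{β₀} ≤ W_{β₀}{S ≤ s}`;
  with `e^{-(β-β₀)s}·W_{β₀}(B) ≤ W_β(B)` on `B ⊆ {S ≤ s}` (`exp_mul_wilsonWeight_le`) this gives the volume-uniform
  `Z`-RATIO bound `log_partitionFunction_sub_ge`:
  `log Z_β - log Z_{β₀} ≥ -(β-β₀)s + #E·(log a + κ log r₀)` whenever `B̄(1,r₀) ⊆ {S ≤ s}`.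
* `exists_apply_mem_of_map_eq_between`: the image of an exact transport meets every non-empty open set.

Elementary given the tree; nothing here is cited as a fact.
-/

noncomputable section

namespace Summit.Ventures.LatticeQCDFlow.Theory2.Lattice

open MeasureTheory Metric Set Literature.MathematicalPhysics.QuantumFieldTheory

/-! ## §0. The items -/

section Defs

variable (d N : ℕ) (G : Type) [Group G] [MetricSpace G] [IsTopologicalGroup G] [CompactSpace G]
  [MeasurableSpace G] [BorelSpace G] (ρ : G →* Matrix (Fin N) (Fin N) ℂ)

/-- **(C2a-E′) EXPANSION LAW BETWEEN COUPLINGS** (OURS, THEORY-2.md §3.3 v2.7): there are `c > 0`, `C` such that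
for every `L ≥ 2`, every `0 ≤ β₀ ≤ β` and every exact LIPSCHITZ transport `T` of `μ_{Λ,β₀}` onto `μ_{Λ,β}` (sup
metric on `G^E`), `Lip(T) ≥ e^{c(β-β₀) - C}` — uniformly in the volume.  Proved for two-sided ball volumes and a
non-constant character in `Scaling/ExactTransportBetween.lean`. [folklore] -/
@[conjecture]
def ExactTransportExpansionBetween : Prop :=
  ∃ c : ℝ, 0 < c ∧ ∃ C : ℝ, ∀ (L : ℕ) [NeZero L], 2 ≤ L → ∀ β₀ β : ℝ, 0 ≤ β₀ → β₀ ≤ β →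
    ∀ (T : GaugeConfig d L G → GaugeConfig d L G) (K : NNReal), LipschitzWith K T →
      (wilsonMeasure (d := d) (L := L) ρ β₀).map T = wilsonMeasure (d := d) (L := L) ρ β →
      Real.exp (c * (β - β₀) - C) ≤ (K : ℝ)

/-- **(C2a-E′-depth) LAYER-DEPTH FORM BETWEEN COUPLINGS** (OURS): there are `c > 0`, `C` such that for every
`L ≥ 2`, every `0 ≤ β₀ ≤ β` and every stack of layers, each `Λ`-Lipschitz for the sup metric, whose composite
transports `μ_{Λ,β₀}` EXACTLY onto `μ_{Λ,β}`: `depth · log Λ ≥ c(β-β₀) - C`. [folklore] -/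
@[conjecture]
def LayerExpansionDepthBetween : Prop :=
  ∃ c : ℝ, 0 < c ∧ ∃ C : ℝ, ∀ (L : ℕ) [NeZero L], 2 ≤ L → ∀ β₀ β : ℝ, 0 ≤ β₀ → β₀ ≤ β →
    ∀ (l : List (GaugeConfig d L G → GaugeConfig d L G)) (Λ : NNReal), (∀ T ∈ l, LipschitzWith Λ T) →
      (wilsonMeasure (d := d) (L := L) ρ β₀).map (compLayers l) = wilsonMeasure (d := d) (L := L) ρ β →
      c * (β - β₀) - C ≤ (l.length : ℝ) * Real.log (Λ : ℝ)

end Defs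

/-! ## §1. Tools: raising the coupling on a sublevel set; sublevel monotonicity; STEP 1′ -/

section Tools

variable {N : ℕ} {G : Type} [Group G] [MetricSpace G] [IsTopologicalGroup G] [CompactSpace G]
  [SecondCountableTopology G] [MeasurableSpace G] [BorelSpace G]
  (ρ : G →* Matrix (Fin N) (Fin N) ℂ)

omit [SecondCountableTopology G] in
omit [SecondCountableTopology G] in
/-- Raising the coupling on a set where `S ≤ s` costs at most the factor `e^{-(β-β₀)s}`:
`e^{-(β-β₀)s}·W_{β₀}(B) ≤ W_β(B)` for `β₀ ≤ β`. [folklore] -/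
theorem exp_mul_wilsonWeight_le {d L : ℕ} [NeZero L] {β₀ β : ℝ} (hβ : β₀ ≤ β)
    {B : Set (GaugeConfig d L G)} (hB : MeasurableSet B) {s : ℝ} (hS : ∀ U ∈ B, wilsonAction ρ U ≤ s) :
    ENNReal.ofReal (Real.exp (-((β - β₀) * s))) * wilsonWeight (d := d) (L := L) ρ β₀ B ≤
      wilsonWeight (d := d) (L := L) ρ β B := by
  unfold wilsonWeight
  rw [withDensity_apply _ hB, withDensity_apply _ hB, ← lintegral_const_mul' _ _ ENNReal.ofReal_ne_top]
  refine setLIntegral_mono' hB fun U hU => ?_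
  rw [← ENNReal.ofReal_mul (Real.exp_pos _).le, ← Real.exp_add]
  exact ENNReal.ofReal_le_ofReal (Real.exp_le_exp.2 (by nlinarith [hS U hU]))

/-- **Sublevel monotonicity** (Chebyshev's order inequality for the comonotone pair `1_{S ≤ s}`, `e^{-β₀S}`): for
`β₀ ≥ 0` and every level `s`, `π{S ≤ s}·Z_Λ(β₀) ≤ W_{β₀}{S ≤ s}`, i.e. `μ_{Λ,β₀}{S ≤ s} ≥ π{S ≤ s}`.  Proof: split
`Z_Λ(β₀) = W_{β₀}{S ≤ s} + W_{β₀}{S > s}` and use `W_{β₀}{S > s} ≤ e^{-β₀s}π{S > s}`,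
`e^{-β₀s}π{S ≤ s} ≤ W_{β₀}{S ≤ s}`. [folklore] -/
theorem pi_sublevel_mul_partitionFunction_le {d L : ℕ} [NeZero L]
    (hρ : Continuous (ρ : G → Matrix (Fin N) (Fin N) ℂ)) {β₀ : ℝ} (hβ₀ : 0 ≤ β₀) (s : ℝ) :
    (Measure.pi fun _ : Edge d L => haarProbability G) {U | wilsonAction ρ U ≤ s} *
        partitionFunction (d := d) (L := L) ρ β₀ ≤
      wilsonWeight (d := d) (L := L) ρ β₀ {U | wilsonAction ρ U ≤ s} := by
  set π : Measure (GaugeConfig d L G) := Measure.pi fun _ : Edge d L => haarProbability G with hπ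
  set B : Set (GaugeConfig d L G) := {U | wilsonAction ρ U ≤ s} with hB
  have hSc := continuous_wilsonAction (d := d) (L := L) ρ hρ
  have hBm : MeasurableSet B := measurableSet_le hSc.measurable measurable_const
  set q : ENNReal := ENNReal.ofReal (Real.exp (-(β₀ * s))) with hq
  have hlo : q * π B ≤ wilsonWeight (d := d) (L := L) ρ β₀ B :=
    le_wilsonWeight_of_le ρ hβ₀ hBm fun U hU => hU
  have hhi : wilsonWeight (d := d) (L := L) ρ β₀ Bᶜ ≤ q * π Bᶜ :=
    wilsonWeight_le_of_le ρ hβ₀ hBm.compl fun U hU => by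
      simp only [hB, mem_compl_iff, mem_setOf_eq, not_le] at hU
      exact hU.le
  have hZ : partitionFunction (d := d) (L := L) ρ β₀ =
      wilsonWeight (d := d) (L := L) ρ β₀ B + wilsonWeight (d := d) (L := L) ρ β₀ Bᶜ := by
    unfold partitionFunction
    rw [measure_add_measure_compl hBm]
  have hπ1 : π B + π Bᶜ = 1 := by rw [measure_add_measure_compl hBm, measure_univ]
  calc π B * partitionFunction (d := d) (L := L) ρ β₀
      = π B * wilsonWeight (d := d) (L := L) ρ β₀ B + π B * wilsonWeight (d := d) (L := L) ρ β₀ Bᶜ := by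
        rw [hZ, mul_add]
    _ ≤ π B * wilsonWeight (d := d) (L := L) ρ β₀ B + π B * (q * π Bᶜ) :=
        add_le_add le_rfl (mul_le_mul' le_rfl hhi)
    _ = π B * wilsonWeight (d := d) (L := L) ρ β₀ B + (q * π B) * π Bᶜ := by ring
    _ ≤ π B * wilsonWeight (d := d) (L := L) ρ β₀ B + wilsonWeight (d := d) (L := L) ρ β₀ B * π Bᶜ :=
        add_le_add le_rfl (mul_le_mul' hlo le_rfl)
    _ = wilsonWeight (d := d) (L := L) ρ β₀ B * (π B + π Bᶜ) := by ring
    _ = wilsonWeight (d := d) (L := L) ρ β₀ B := by rw [hπ1, mul_one]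

/-- **The `Z`-ratio between couplings from a low-action ball**: if `S ≤ s` on `B̄(1, r₀)` (`0 < r₀ ≤ 1`) and the
one-link balls have Haar mass `≥ a·r^κ`, then for `0 ≤ β₀ ≤ β`
`log Z_Λ(β) - log Z_Λ(β₀) ≥ -(β-β₀)s + #E·(log a + κ·log r₀)`. [folklore] -/
theorem log_partitionFunction_sub_ge {d L : ℕ} [NeZero L]
    (hρ : Continuous (ρ : G → Matrix (Fin N) (Fin N) ℂ)) (htr : ∀ g, (ρ g).trace.re ≤ N)
    {β₀ β : ℝ} (hβ₀ : 0 ≤ β₀) (hβ : β₀ ≤ β) {κ : ℕ} {a : ℝ} (ha : 0 < a)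
    (hlo : ∀ (g : G) (r : ℝ), 0 < r → r ≤ 1 → a * r ^ κ ≤ (haarProbability G (closedBall g r)).toReal)
    {r₀ s : ℝ} (hr₀ : 0 < r₀) (hr₀1 : r₀ ≤ 1)
    (hS : ∀ U : GaugeConfig d L G, dist U 1 ≤ r₀ → wilsonAction ρ U ≤ s) :
    -((β - β₀) * s) + Fintype.card (Edge d L) * (Real.log a + κ * Real.log r₀) ≤
      Real.log (partitionFunction (d := d) (L := L) ρ β).toReal -
        Real.log (partitionFunction (d := d) (L := L) ρ β₀).toReal := by
  set π : Measure (GaugeConfig d L G) := Measure.pi fun _ : Edge d L => haarProbability G with hπ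
  set B : Set (GaugeConfig d L G) := {U | wilsonAction ρ U ≤ s} with hB
  have hβ0 : 0 ≤ β := hβ₀.trans hβ
  have hSc := continuous_wilsonAction (d := d) (L := L) ρ hρ
  have hBm : MeasurableSet B := measurableSet_le hSc.measurable measurable_const
  have hZtop : partitionFunction (d := d) (L := L) ρ β ≠ ⊤ :=
    ne_top_of_le_ne_top ENNReal.one_ne_top (partitionFunction_le_one ρ htr hβ0)
  have hZ0 : partitionFunction (d := d) (L := L) ρ β ≠ 0 := partitionFunction_ne_zero ρ hρ β
  have hZ₀top : partitionFunction (d := d) (L := L) ρ β₀ ≠ ⊤ :=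
    ne_top_of_le_ne_top ENNReal.one_ne_top (partitionFunction_le_one ρ htr hβ₀)
  have hZ₀0 : partitionFunction (d := d) (L := L) ρ β₀ ≠ 0 := partitionFunction_ne_zero ρ hρ β₀
  set Z : ℝ := (partitionFunction (d := d) (L := L) ρ β).toReal with hZdef
  set Z₀ : ℝ := (partitionFunction (d := d) (L := L) ρ β₀).toReal with hZ₀def
  have hZpos : 0 < Z := ENNReal.toReal_pos hZ0 hZtop
  have hZ₀pos : 0 < Z₀ := ENNReal.toReal_pos hZ₀0 hZ₀top
  -- the chain in `ℝ≥0∞`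
  have h1 : ENNReal.ofReal (Real.exp (-((β - β₀) * s))) * (π B * partitionFunction (d := d) (L := L) ρ β₀) ≤
      partitionFunction (d := d) (L := L) ρ β :=
    calc _ ≤ ENNReal.ofReal (Real.exp (-((β - β₀) * s))) * wilsonWeight (d := d) (L := L) ρ β₀ B :=
          mul_le_mul' le_rfl (pi_sublevel_mul_partitionFunction_le ρ hρ hβ₀ s)
      _ ≤ wilsonWeight (d := d) (L := L) ρ β B := exp_mul_wilsonWeight_le ρ hβ hBm fun U hU => hU
      _ ≤ partitionFunction (d := d) (L := L) ρ β := by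
          unfold partitionFunction; exact measure_mono (subset_univ _)
  -- the low-action ball sits inside the sublevel set
  have hball : closedBall (1 : GaugeConfig d L G) r₀ ⊆ B := fun U hU => hS U (mem_closedBall.1 hU)
  have h2 : (a * r₀ ^ κ) ^ Fintype.card (Edge d L) ≤ (π B).toReal :=
    (pow_le_pi_closedBall ha.le hlo (1 : GaugeConfig d L G) hr₀ hr₀1).trans
      (ENNReal.toReal_mono (measure_ne_top _ _) (measure_mono hball))
  have h3 := ENNReal.toReal_mono hZtop h1
  rw [ENNReal.toReal_mul, ENNReal.toReal_mul, ENNReal.toReal_ofReal (Real.exp_pos _).le] at h3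
  have h4 : Real.exp (-((β - β₀) * s)) * ((a * r₀ ^ κ) ^ Fintype.card (Edge d L) * Z₀) ≤ Z :=
    le_trans (mul_le_mul_of_nonneg_left (mul_le_mul_of_nonneg_right h2 hZ₀pos.le) (Real.exp_pos _).le) h3
  have hlhs : 0 < Real.exp (-((β - β₀) * s)) * ((a * r₀ ^ κ) ^ Fintype.card (Edge d L) * Z₀) := by
    positivity
  have h5 := Real.log_le_log hlhs h4
  rw [Real.log_mul (Real.exp_pos _).ne' (by positivity), Real.log_exp,
    Real.log_mul (by positivity) hZ₀pos.ne', Real.log_pow, Real.log_mul ha.ne' (by positivity),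
    Real.log_pow] at h5
  linarith

/-- **STEP 1′ — the density-ratio step between couplings**: for an exact `K`-Lipschitz transport `T` of
`μ_{Λ,β₀}` onto `μ_{Λ,β}` (`K > 0`, `β₀, β ≥ 0`) and two-sided ball volumes,
`log Z_Λ(β) - log Z_Λ(β₀) + β·S(Tx) - β₀·S(x) ≤ #E·(log(A/a) + κ·log K)` at every `x` (compare
`μ_{β₀}(B̄(x,r)) ≤ μ_β(B̄(Tx,Kr))` as `r → 0`). [folklore] -/
theorem log_partitionFunction_add_le_between {d L : ℕ} [NeZero L]
    (hρ : Continuous (ρ : G → Matrix (Fin N) (Fin N) ℂ)) (htr : ∀ g, (ρ g).trace.re ≤ N)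
    {κ : ℕ} {a A : ℝ} (ha : 0 < a) (hA : 0 < A)
    (hlo : ∀ (g : G) (r : ℝ), 0 < r → r ≤ 1 → a * r ^ κ ≤ (haarProbability G (closedBall g r)).toReal)
    (hup : ∀ (g : G) (r : ℝ), 0 < r → (haarProbability G (closedBall g r)).toReal ≤ A * r ^ κ)
    {β₀ β : ℝ} (hβ₀ : 0 ≤ β₀) (hβ0 : 0 ≤ β) {T : GaugeConfig d L G → GaugeConfig d L G} {K : NNReal}
    (hK0 : 0 < (K : ℝ)) (hT : LipschitzWith K T)
    (hmap : (wilsonMeasure (d := d) (L := L) ρ β₀).map T = wilsonMeasure (d := d) (L := L) ρ β)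
    (x : GaugeConfig d L G) :
    Real.log (partitionFunction (d := d) (L := L) ρ β).toReal -
        Real.log (partitionFunction (d := d) (L := L) ρ β₀).toReal +
        β * wilsonAction ρ (T x) - β₀ * wilsonAction ρ x ≤
      Fintype.card (Edge d L) * (Real.log (A / a) + κ * Real.log K) := by
  set π : Measure (GaugeConfig d L G) := Measure.pi fun _ : Edge d L => haarProbability G with hπ
  set S : GaugeConfig d L G → ℝ := wilsonAction (d := d) (L := L) ρ with hSdef
  have hScont : Continuous S := continuous_wilsonAction (d := d) (L := L) ρ hρ
  have hTm : Measurable T := hT.continuous.measurable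
  set nE : ℕ := Fintype.card (Edge d L) with hnE
  have hZ0 : partitionFunction (d := d) (L := L) ρ β ≠ 0 := partitionFunction_ne_zero ρ hρ β
  have hZtop : partitionFunction (d := d) (L := L) ρ β ≠ ⊤ :=
    ne_top_of_le_ne_top ENNReal.one_ne_top (partitionFunction_le_one ρ htr hβ0)
  set Z : ℝ := (partitionFunction (d := d) (L := L) ρ β).toReal with hZdef
  have hZpos : 0 < Z := ENNReal.toReal_pos hZ0 hZtop
  have hZ₀0 : partitionFunction (d := d) (L := L) ρ β₀ ≠ 0 := partitionFunction_ne_zero ρ hρ β₀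
  have hZ₀top : partitionFunction (d := d) (L := L) ρ β₀ ≠ ⊤ :=
    ne_top_of_le_ne_top ENNReal.one_ne_top (partitionFunction_le_one ρ htr hβ₀)
  set Z₀ : ℝ := (partitionFunction (d := d) (L := L) ρ β₀).toReal with hZ₀def
  have hZ₀pos : 0 < Z₀ := ENNReal.toReal_pos hZ₀0 hZ₀top
  have hμT : ∀ B : Set (GaugeConfig d L G), MeasurableSet B →
      wilsonMeasure (d := d) (L := L) ρ β B = wilsonMeasure (d := d) (L := L) ρ β₀ (T ⁻¹' B) := fun B hB => by
    rw [← hmap, Measure.map_apply hTm hB]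
  have hμW : ∀ (β' : ℝ) (B : Set (GaugeConfig d L G)),
      wilsonMeasure (d := d) (L := L) ρ β' B = (partitionFunction ρ β')⁻¹ * wilsonWeight ρ β' B := fun β' B => by
    show ((partitionFunction ρ β')⁻¹ • wilsonWeight ρ β') B = _
    rw [Measure.smul_apply, smul_eq_mul]
  refine le_of_forall_pos_le_add fun ε hε => ?_
  have hε' : 0 < ε / (β + β₀ + 1) := by positivity
  have hβε : (β + β₀) * (ε / (β + β₀ + 1)) ≤ ε := by
    rw [mul_div_assoc', div_le_iff₀ (by positivity)]; nlinarith
  obtain ⟨δ₁, hδ₁, hδ₁S⟩ := Metric.continuous_iff.1 hScont (T x) (ε / (β + β₀ + 1)) hε'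
  obtain ⟨δ₀, hδ₀, hδ₀S⟩ := Metric.continuous_iff.1 hScont x (ε / (β + β₀ + 1)) hε'
  set r : ℝ := min (min 1 (δ₀ / 2)) (δ₁ / (2 * K)) with hr
  have hr0 : 0 < r := lt_min (lt_min one_pos (by positivity)) (by positivity)
  have hr1 : r ≤ 1 := (min_le_left _ _).trans (min_le_left _ _)
  have hrδ₀ : r < δ₀ := lt_of_le_of_lt ((min_le_left _ _).trans (min_le_right _ _)) (by linarith)
  have hKr : K * r < δ₁ := by
    have : r ≤ δ₁ / (2 * K) := min_le_right _ _
    calc (K : ℝ) * r ≤ K * (δ₁ / (2 * K)) := mul_le_mul_of_nonneg_left this hK0.le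
      _ = δ₁ / 2 := by field_simp
      _ < δ₁ := by linarith
  -- (i) `Z₀⁻¹ e^{-β₀(S x + ε')} (a r^κ)^{nE} ≤ μ₀(B̄(x, r))`
  have h1 := pow_le_pi_closedBall ha.le hlo x hr0 hr1
  have hSB₀ : ∀ U ∈ closedBall x r, S U ≤ S x + ε / (β + β₀ + 1) := fun U hU => by
    have hd : dist U x < δ₀ := lt_of_le_of_lt (mem_closedBall.1 hU) hrδ₀
    have := hδ₀S U hd
    rw [Real.dist_eq] at this
    linarith [(abs_lt.1 this).2]
  have h3₀ := le_wilsonWeight_of_le ρ hβ₀ measurableSet_closedBall hSB₀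
  -- (ii) `μ₀(B̄(x,r)) ≤ μ(B̄(Tx, K r))`
  have hsub : closedBall x r ⊆ T ⁻¹' closedBall (T x) (K * r) := fun u hu => by
    rw [mem_preimage, mem_closedBall]
    exact (hT.dist_le_mul u x).trans (mul_le_mul_of_nonneg_left (mem_closedBall.1 hu) K.coe_nonneg)
  have h2 : wilsonMeasure (d := d) (L := L) ρ β₀ (closedBall x r) ≤
      wilsonMeasure (d := d) (L := L) ρ β (closedBall (T x) (K * r)) := by
    rw [hμT _ measurableSet_closedBall]; exact measure_mono hsub
  -- (iii) `μ(B̄(Tx, Kr)) ≤ Z⁻¹ e^{-β(S(Tx) - ε')} (A (Kr)^κ)^{nE}`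
  have hSB : ∀ U ∈ closedBall (T x) (K * r), S (T x) - ε / (β + β₀ + 1) ≤ S U := fun U hU => by
    have hd : dist U (T x) < δ₁ := lt_of_le_of_lt (mem_closedBall.1 hU) hKr
    have := hδ₁S U hd
    rw [Real.dist_eq] at this
    linarith [(abs_lt.1 this).1]
  have h3 := wilsonWeight_le_of_le ρ hβ0 measurableSet_closedBall hSB
  have h4 := pi_closedBall_le_pow hup (T x) (mul_pos hK0 hr0)
  have hfin : (partitionFunction (d := d) (L := L) ρ β)⁻¹ *
      (ENNReal.ofReal (Real.exp (-(β * (S (T x) - ε / (β + β₀ + 1))))) * π (closedBall (T x) (K * r))) ≠ ⊤ :=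
    ENNReal.mul_ne_top (ENNReal.inv_ne_top.2 hZ0) (ENNReal.mul_ne_top ENNReal.ofReal_ne_top (measure_ne_top _ _))
  have h5 : (partitionFunction (d := d) (L := L) ρ β₀)⁻¹ *
        (ENNReal.ofReal (Real.exp (-(β₀ * (S x + ε / (β + β₀ + 1))))) * π (closedBall x r)) ≤
      (partitionFunction (d := d) (L := L) ρ β)⁻¹ *
        (ENNReal.ofReal (Real.exp (-(β * (S (T x) - ε / (β + β₀ + 1))))) * π (closedBall (T x) (K * r))) :=
    calc _ ≤ wilsonMeasure (d := d) (L := L) ρ β₀ (closedBall x r) := by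
          rw [hμW]; exact mul_le_mul' le_rfl h3₀
      _ ≤ wilsonMeasure (d := d) (L := L) ρ β (closedBall (T x) (K * r)) := h2
      _ ≤ _ := by rw [hμW]; exact mul_le_mul' le_rfl h3
  have h6 := ENNReal.toReal_mono hfin h5
  rw [ENNReal.toReal_mul, ENNReal.toReal_mul, ENNReal.toReal_mul, ENNReal.toReal_mul, ENNReal.toReal_inv,
    ENNReal.toReal_inv, ENNReal.toReal_ofReal (Real.exp_pos _).le, ENNReal.toReal_ofReal (Real.exp_pos _).le]
    at h6
  have h7 : Z₀⁻¹ * (Real.exp (-(β₀ * (S x + ε / (β + β₀ + 1)))) * (a * r ^ κ) ^ nE) ≤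
      Z⁻¹ * (Real.exp (-(β * (S (T x) - ε / (β + β₀ + 1)))) * (A * (K * r) ^ κ) ^ nE) :=
    calc Z₀⁻¹ * (Real.exp (-(β₀ * (S x + ε / (β + β₀ + 1)))) * (a * r ^ κ) ^ nE)
        ≤ Z₀⁻¹ * (Real.exp (-(β₀ * (S x + ε / (β + β₀ + 1)))) * (π (closedBall x r)).toReal) :=
          mul_le_mul_of_nonneg_left (mul_le_mul_of_nonneg_left h1 (Real.exp_pos _).le)
            (inv_nonneg.2 hZ₀pos.le)
      _ ≤ Z⁻¹ * (Real.exp (-(β * (S (T x) - ε / (β + β₀ + 1)))) * (π (closedBall (T x) (K * r))).toReal) := h6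
      _ ≤ Z⁻¹ * (Real.exp (-(β * (S (T x) - ε / (β + β₀ + 1)))) * (A * (K * r) ^ κ) ^ nE) :=
          mul_le_mul_of_nonneg_left (mul_le_mul_of_nonneg_left h4 (Real.exp_pos _).le)
            (inv_nonneg.2 hZpos.le)
  have hlhs : 0 < Z₀⁻¹ * (Real.exp (-(β₀ * (S x + ε / (β + β₀ + 1)))) * (a * r ^ κ) ^ nE) := by positivity
  have h8 := Real.log_le_log hlhs h7
  rw [Real.log_mul (inv_pos.2 hZ₀pos).ne' (by positivity), Real.log_inv,
    Real.log_mul (Real.exp_pos _).ne' (by positivity), Real.log_exp, Real.log_pow,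
    Real.log_mul ha.ne' (pow_pos hr0 _).ne', Real.log_pow,
    Real.log_mul (inv_pos.2 hZpos).ne' (by positivity), Real.log_inv,
    Real.log_mul (Real.exp_pos _).ne' (by positivity), Real.log_exp, Real.log_pow,
    Real.log_mul hA.ne' (by positivity), Real.log_pow, Real.log_mul hK0.ne' hr0.ne'] at h8
  rw [Real.log_div hA.ne' ha.ne']
  linarith only [h8, hβε]

omit [SecondCountableTopology G] in
/-- The image of an exact transport between couplings meets every non-empty open set (`μ_{Λ,β}` charges open sets;
`T` measurable, `β ≥ 0`). [folklore] -/
theorem exists_apply_mem_of_map_eq_between {d L : ℕ} [NeZero L] [SecondCountableTopology G]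
    (htr : ∀ g, (ρ g).trace.re ≤ N) (htr' : ∀ g, -(N : ℝ) ≤ (ρ g).trace.re) {β₀ β : ℝ} (hβ : 0 ≤ β)
    {T : GaugeConfig d L G → GaugeConfig d L G} (hTm : Measurable T)
    (hmap : (wilsonMeasure (d := d) (L := L) ρ β₀).map T = wilsonMeasure (d := d) (L := L) ρ β)
    {O : Set (GaugeConfig d L G)} (hO : IsOpen O) (hne : O.Nonempty) : ∃ x, T x ∈ O := by
  haveI : (haarProbability G).IsHaarMeasure := Measure.isHaarMeasure_haarMeasure _
  have hpos : 0 < wilsonMeasure (d := d) (L := L) ρ β O :=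
    wilsonMeasure_pos_of_pi_pos ρ htr htr' hβ hO.measurableSet
      (hO.measure_pos (Measure.pi fun _ : Edge d L => haarProbability G) hne)
  rw [← hmap, Measure.map_apply hTm hO.measurableSet] at hpos
  exact nonempty_of_measure_ne_zero hpos.ne'

end Tools

end Summit.Ventures.LatticeQCDFlow.Theory2.Lattice
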